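import Literature.Analysis.FluidPDE.ParabolicComparison
import HarnessLib

/-!
# The local time-integrated class for `v_t + a·∇v − Δv = 0`

Analysis/FluidPDE support file, first layer of the proof of the named fact
`Literature.Analysis.FluidPDE.KNSS2009_lemma21` (`FluidPDE/KNSSSwirlLiouville`: Koch–Nadirashvili–
Seregin–Šverák 2009, Lemma 2.1 — stability of the strong maximum principle — *as printed*, on a
bounded domain `Ω`, with `δ` uniform over all drifts `‖a‖ ≤ A` and all solutions `|u| ≤ M`).
The fact is vendored for the elementary solution class "`C²` slices on `Ω`, `∇u` and `Δu`
jointly continuous on `(0, T] × Ω`, equation in time-integrated form"; this file packages that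
class **locally** (on a time set `S` and an open space set `U`, no global bounds) as the
predicate `IsDriftHeatSolutionOn a v A S U` and proves for it:

* closure under `v ↦ −v` and `v ↦ v + c` (the equation is linear; `M − u` and `u + M` are the
  nonnegative solutions the proof of Lemma 2.1 works with);
* interval integrability of the integrand, a local time-Lipschitz bound and **joint continuity**
  on `[t₁, t₂] × U` (`IsDriftHeatSolutionOn.continuousOn_uncurry`);

The comparison principle for this class (Lieberman 1996, Ch. II, Cor. 2.5, localised) is the
companion file `DriftHeatLocalComparison`.

## References

* G. M. Lieberman, *Second Order Parabolic Differential Equations*, World Scientific (1996),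
  Ch. II §1, Lemma 2.1, Lemma 2.3, Corollary 2.5 (pp. 7–10). [Lieberman1996]
* G. Koch, N. Nadirashvili, G. Seregin, V. Šverák, *Liouville theorems for the Navier–Stokes
  equations and applications*, Acta Math. 203 (2009) = arXiv:0709.3599, §2 and Lemma 2.1
  (p. 5). [KochNadirashviliSereginSverak2009]
-/

noncomputable section

open MeasureTheory Set Function Filter TopologicalSpace InnerProductSpace Metric
open scoped RealInnerProductSpace Laplacian ContDiff Topology

namespace Literature.Analysis.FluidPDE

variable {E : Type*} [NormedAddCommGroup E] [InnerProductSpace ℝ E] [FiniteDimensional ℝ E]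
  [MeasurableSpace E]

/-! ### The local solution class -/

omit [InnerProductSpace ℝ E] [FiniteDimensional ℝ E] [MeasurableSpace E] in
/-- A time slice `r ↦ F(r, x)` of a function continuous on `S × U` is continuous on every
`S' ⊆ S`, for `x ∈ U` (composition with `r ↦ (r, x)`, arguments given explicitly to keep
unification first order). [folklore] -/
theorem continuousOn_time_slice {X : Type*} [TopologicalSpace X] {F : ℝ × E → X} {S : Set ℝ}
    {U : Set E} (hF : ContinuousOn F (S ×ˢ U)) {x : E} (hx : x ∈ U) {S' : Set ℝ}
    (hS : S' ⊆ S) : ContinuousOn (fun r => F (r, x)) S' :=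
  ContinuousOn.comp (g := F) (f := fun r : ℝ => (r, x)) hF
    (continuous_id.prodMk continuous_const).continuousOn fun _ hr => ⟨hS hr, hx⟩

/-- **The local time-integrated solution class of the drift–heat equation**
`v_t + a·∇v − Δv = 0` (KNSS 2009, §2, p. 5, in the elementary rendering of
`KNSS2009_lemma21`): on a set of times `S` and a set `U` of space points, the drift `a` is
jointly measurable with `‖a(t, x)‖ ≤ A`, every slice `v(t, ·)`, `t ∈ S`, is `C²` on `U`, the
maps `(t, x) ↦ ∇v(t, ·)(x)` and `(t, x) ↦ Δv(t, ·)(x)` are continuous on `S × U`, and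
`v(t, x) − v(s, x) = ∫ₛᵗ (Δv(r, ·)(x) − Dv(r, ·)(x)[a(r, x)]) dr` for `x ∈ U`, `s ≤ t` in `S`
(such a `v` is locally Lipschitz in `t` and solves the equation in distributions). [cite: KochNadirashviliSereginSverak2009, §2 (p. 5), solution class of Lemma 2.1 (elementary rendering)] -/
structure IsDriftHeatSolutionOn (a : ℝ → E → E) (v : ℝ → E → ℝ) (A : ℝ) (S : Set ℝ)
    (U : Set E) : Prop where
  measurable_drift : Measurable (uncurry a)
  norm_drift_le : ∀ t ∈ S, ∀ x ∈ U, ‖a t x‖ ≤ A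
  contDiffOn : ∀ t ∈ S, ContDiffOn ℝ 2 (v t) U
  continuousOn_fderiv : ContinuousOn (fun p : ℝ × E => fderiv ℝ (v p.1) p.2) (S ×ˢ U)
  continuousOn_laplacian : ContinuousOn (fun p : ℝ × E => (Δ (v p.1)) p.2) (S ×ˢ U)
  integral_eq : ∀ x ∈ U, ∀ s ∈ S, ∀ t ∈ S, s ≤ t →
    v t x - v s x = ∫ r in s..t, ((Δ (v r)) x - fderiv ℝ (v r) x (a r x))

namespace IsDriftHeatSolutionOn

variable {a : ℝ → E → E} {v : ℝ → E → ℝ} {A : ℝ} {S : Set ℝ} {U : Set E}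

/-- Restriction of the class to smaller sets. [folklore] -/
theorem mono (hv : IsDriftHeatSolutionOn a v A S U) {S' : Set ℝ} {U' : Set E} (hS : S' ⊆ S)
    (hU : U' ⊆ U) : IsDriftHeatSolutionOn a v A S' U' where
  measurable_drift := hv.measurable_drift
  norm_drift_le t ht x hx := hv.norm_drift_le t (hS ht) x (hU hx)
  contDiffOn t ht := (hv.contDiffOn t (hS ht)).mono hU
  continuousOn_fderiv := hv.continuousOn_fderiv.mono (prod_mono hS hU)
  continuousOn_laplacian := hv.continuousOn_laplacian.mono (prod_mono hS hU)
  integral_eq x hx s hs t ht hst := hv.integral_eq x (hU hx) s (hS hs) t (hS ht) hst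

/-- The drift bound is nonnegative as soon as `S × U` is nonempty. [folklore] -/
theorem drift_bound_nonneg (hv : IsDriftHeatSolutionOn a v A S U) {t : ℝ} (ht : t ∈ S) {x : E}
    (hx : x ∈ U) : 0 ≤ A :=
  (norm_nonneg _).trans (hv.norm_drift_le t ht x hx)

/-- The class is closed under `v ↦ −v` (the equation is linear). [folklore] -/
theorem neg (hv : IsDriftHeatSolutionOn a v A S U) :
    IsDriftHeatSolutionOn a (fun t x => -v t x) A S U where
  measurable_drift := hv.measurable_drift
  norm_drift_le := hv.norm_drift_le
  contDiffOn t ht := (hv.contDiffOn t ht).neg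
  continuousOn_fderiv := by
    have h : (fun p : ℝ × E => fderiv ℝ (fun x => -v p.1 x) p.2) =
        fun p => -fderiv ℝ (v p.1) p.2 := funext fun p => fderiv_fun_neg
    rw [h]
    exact hv.continuousOn_fderiv.neg
  continuousOn_laplacian := by
    have h : (fun p : ℝ × E => (Δ fun x => -v p.1 x) p.2) = fun p => -(Δ (v p.1)) p.2 :=
      funext fun p => by
        rw [show (fun x => -v p.1 x) = -v p.1 from rfl, InnerProductSpace.laplacian_neg]
        rfl
    rw [h]
    exact hv.continuousOn_laplacian.neg
  integral_eq x hx s hs t ht hst := by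
    have h1 : (fun r => (Δ fun y => -v r y) x - fderiv ℝ (fun y => -v r y) x (a r x)) =
        fun r => -((Δ (v r)) x - fderiv ℝ (v r) x (a r x)) := by
      funext r
      rw [show (fun y => -v r y) = -v r from rfl, InnerProductSpace.laplacian_neg, fderiv_neg]
      simp only [Pi.neg_apply, neg_apply]
      ring
    rw [h1, intervalIntegral.integral_neg, ← hv.integral_eq x hx s hs t ht hst]
    ring

/-- The class is closed under `v ↦ v + c` (on an open `U`). [folklore] -/
theorem add_const (hv : IsDriftHeatSolutionOn a v A S U) (hU : IsOpen U) (hS : S.OrdConnected)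
    (c : ℝ) : IsDriftHeatSolutionOn a (fun t x => v t x + c) A S U where
  measurable_drift := hv.measurable_drift
  norm_drift_le := hv.norm_drift_le
  contDiffOn t ht := (hv.contDiffOn t ht).add contDiffOn_const
  continuousOn_fderiv := by
    have h : (fun p : ℝ × E => fderiv ℝ (fun x => v p.1 x + c) p.2) =
        fun p => fderiv ℝ (v p.1) p.2 := funext fun p => fderiv_add_const c
    rw [h]
    exact hv.continuousOn_fderiv
  continuousOn_laplacian := by
    refine hv.continuousOn_laplacian.congr fun p hp => ?_
    have hc : ContDiffAt ℝ 2 (v p.1) p.2 := (hv.contDiffOn p.1 hp.1).contDiffAt (hU.mem_nhds hp.2)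
    show (Δ fun x => v p.1 x + c) p.2 = (Δ (v p.1)) p.2
    rw [show (fun x => v p.1 x + c) = v p.1 + fun _ => c from rfl, hc.laplacian_add contDiffAt_const,
      laplacian_const]
    simp
  integral_eq x hx s hs t ht hst := by
    have h1 : ∀ r ∈ S, (Δ fun y => v r y + c) x - fderiv ℝ (fun y => v r y + c) x (a r x) =
        (Δ (v r)) x - fderiv ℝ (v r) x (a r x) := by
      intro r hr
      have hc : ContDiffAt ℝ 2 (v r) x := (hv.contDiffOn r hr).contDiffAt (hU.mem_nhds hx)
      rw [fderiv_add_const,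
        show (fun y => v r y + c) = v r + fun _ => c from rfl, hc.laplacian_add contDiffAt_const,
        laplacian_const]
      simp
    have hsub : uIcc s t ⊆ S := by
      rw [uIcc_of_le hst]
      exact hS.out hs ht
    rw [intervalIntegral.integral_congr fun r hr => h1 r (hsub hr),
      ← hv.integral_eq x hx s hs t ht hst]
    ring

/-- The integrand `r ↦ Δv(r, ·)(x) − Dv(r, ·)(x)[a(r, x)]` of the class is interval integrable
on every `[s, t] ⊆ S`, `x ∈ U`: the two derivative terms are continuous in `r`, the drift is
measurable and bounded. [folklore] -/
theorem intervalIntegrable [BorelSpace E] (hv : IsDriftHeatSolutionOn a v A S U) {x : E}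
    (hx : x ∈ U) {s t : ℝ} (hst : s ≤ t) (hS : Icc s t ⊆ S) :
    IntervalIntegrable (fun r => (Δ (v r)) x - fderiv ℝ (v r) x (a r x)) volume s t := by
  have hΔc : ContinuousOn (fun r => (Δ (v r)) x) (Icc s t) :=
    continuousOn_time_slice (F := fun p : ℝ × E => (Δ (v p.1)) p.2) hv.continuousOn_laplacian
      hx hS
  have hDc : ContinuousOn (fun r => fderiv ℝ (v r) x) (Icc s t) :=
    continuousOn_time_slice (F := fun p : ℝ × E => fderiv ℝ (v p.1) p.2) hv.continuousOn_fderiv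
      hx hS
  obtain ⟨C₁, hC₁⟩ := isCompact_Icc.exists_bound_of_continuousOn hΔc
  obtain ⟨C₂, hC₂⟩ := isCompact_Icc.exists_bound_of_continuousOn hDc
  have hax : Measurable fun r : ℝ => a r x :=
    hv.measurable_drift.comp (measurable_id.prodMk measurable_const)
  have hmeas : AEStronglyMeasurable (fun r => (Δ (v r)) x - fderiv ℝ (v r) x (a r x))
      (volume.restrict (Icc s t)) := by
    refine (hΔc.aestronglyMeasurable measurableSet_Icc).sub ?_
    have h1 : AEStronglyMeasurable (fun r => (fderiv ℝ (v r) x, a r x))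
        (volume.restrict (Icc s t)) :=
      (hDc.aestronglyMeasurable measurableSet_Icc).prodMk hax.aestronglyMeasurable
    exact (isBoundedBilinearMap_apply (𝕜 := ℝ) (E := E) (F := ℝ)).continuous
      |>.comp_aestronglyMeasurable h1
  have hbound : ∀ᵐ r ∂(volume.restrict (Icc s t)),
      ‖(Δ (v r)) x - fderiv ℝ (v r) x (a r x)‖ ≤ C₁ + C₂ * |A| := by
    filter_upwards [ae_restrict_mem measurableSet_Icc] with r hr
    have hD : ‖fderiv ℝ (v r) x‖ ≤ C₂ := hC₂ r hr
    have h2 : ‖fderiv ℝ (v r) x (a r x)‖ ≤ C₂ * |A| :=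
      (ContinuousLinearMap.le_opNorm _ _).trans (mul_le_mul hD
        ((hv.norm_drift_le r (hS hr) x hx).trans (le_abs_self A)) (norm_nonneg _)
        ((norm_nonneg _).trans hD))
    exact (norm_sub_le _ _).trans (add_le_add (hC₁ r hr) h2)
  have hint : IntegrableOn (fun r => (Δ (v r)) x - fderiv ℝ (v r) x (a r x)) (Icc s t) volume :=
    IntegrableOn.of_bound measure_Icc_lt_top hmeas _ hbound
  rw [intervalIntegrable_iff_integrableOn_Icc_of_le hst]
  exact hint

/-- **Local time-Lipschitz bound**: on `[t₁, t₂] × C`, `[t₁, t₂] ⊆ S`, `C ⊆ U` compact, one has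
`|v(t, x) − v(s, x)| ≤ L |t − s|` (the integrand is bounded on the compact `[t₁, t₂] × C` by the
joint continuity of `∇v`, `Δv`). [folklore] -/
theorem exists_abs_sub_le (hv : IsDriftHeatSolutionOn a v A S U) {t₁ t₂ : ℝ}
    (hS : Icc t₁ t₂ ⊆ S) {C : Set E} (hC : IsCompact C) (hCU : C ⊆ U) :
    ∃ L : ℝ, ∀ x ∈ C, ∀ s ∈ Icc t₁ t₂, ∀ t ∈ Icc t₁ t₂, |v t x - v s x| ≤ L * |t - s| := by
  have hK : IsCompact (Icc t₁ t₂ ×ˢ C) := isCompact_Icc.prod hC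
  have hKsub : Icc t₁ t₂ ×ˢ C ⊆ S ×ˢ U := prod_mono hS hCU
  obtain ⟨C₁, hC₁⟩ := hK.exists_bound_of_continuousOn (hv.continuousOn_laplacian.mono hKsub)
  obtain ⟨C₂, hC₂⟩ := hK.exists_bound_of_continuousOn (hv.continuousOn_fderiv.mono hKsub)
  refine ⟨C₁ + C₂ * |A|, fun x hx s hs t ht => ?_⟩
  have hG : ∀ r ∈ Icc t₁ t₂, ‖(Δ (v r)) x - fderiv ℝ (v r) x (a r x)‖ ≤ C₁ + C₂ * |A| := by
    intro r hr
    have h1 : ‖(Δ (v r)) x‖ ≤ C₁ := hC₁ (r, x) ⟨hr, hx⟩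
    have hD : ‖fderiv ℝ (v r) x‖ ≤ C₂ := hC₂ (r, x) ⟨hr, hx⟩
    have h2 : ‖fderiv ℝ (v r) x (a r x)‖ ≤ C₂ * |A| :=
      (ContinuousLinearMap.le_opNorm _ _).trans (mul_le_mul hD
        ((hv.norm_drift_le r (hS hr) x (hCU hx)).trans (le_abs_self A)) (norm_nonneg _)
        ((norm_nonneg _).trans hD))
    exact (norm_sub_le _ _).trans (add_le_add h1 h2)
  rcases le_total s t with hst | hts
  · rw [hv.integral_eq x (hCU hx) s (hS hs) t (hS ht) hst, ← Real.norm_eq_abs]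
    refine intervalIntegral.norm_integral_le_of_norm_le_const fun r hr => hG r ?_
    rw [uIoc_of_le hst] at hr
    exact ⟨hs.1.trans hr.1.le, hr.2.trans ht.2⟩
  · rw [abs_sub_comm, hv.integral_eq x (hCU hx) t (hS ht) s (hS hs) hts, ← Real.norm_eq_abs,
      abs_sub_comm]
    refine intervalIntegral.norm_integral_le_of_norm_le_const fun r hr => hG r ?_
    rw [uIoc_of_le hts] at hr
    exact ⟨ht.1.trans hr.1.le, hr.2.trans hs.2⟩

/-- **Joint continuity** of a member of the local class on `[t₁, t₂] × U` (`[t₁, t₂] ⊆ S`,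
`U` open): locally Lipschitz in `t` uniformly in `x` (`exists_abs_sub_le`) and continuous in `x`
for each `t`. [folklore] -/
theorem continuousOn_uncurry (hv : IsDriftHeatSolutionOn a v A S U) (hU : IsOpen U)
    {t₁ t₂ : ℝ} (hS : Icc t₁ t₂ ⊆ S) : ContinuousOn (uncurry v) (Icc t₁ t₂ ×ˢ U) := by
  rintro ⟨t₀, x₀⟩ ⟨ht₀, hx₀⟩
  obtain ⟨r, hr, hrU⟩ := Metric.isOpen_iff.1 hU x₀ hx₀
  have hCU : closedBall x₀ (r / 2) ⊆ U := (closedBall_subset_ball (by linarith)).trans hrU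
  obtain ⟨L, hL⟩ := hv.exists_abs_sub_le hS (isCompact_closedBall x₀ (r / 2)) hCU
  have hcont : ContinuousOn (uncurry v) (Icc t₁ t₂ ×ˢ closedBall x₀ (r / 2)) := by
    refine continuousOn_prod_of_continuousOn_lipschitzOnWith _ (Real.toNNReal L)
      (fun t ht => ((hv.contDiffOn t (hS ht)).continuousOn).mono hCU) (fun x hx => ?_)
    refine LipschitzOnWith.of_dist_le' fun t ht s hs => ?_
    rw [Real.dist_eq, Real.dist_eq]
    exact hL x hx s hs t ht
  have hmem : Icc t₁ t₂ ×ˢ closedBall x₀ (r / 2) ∈ 𝓝[Icc t₁ t₂ ×ˢ U] (t₀, x₀) := by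
    refine mem_nhdsWithin.2 ⟨univ ×ˢ ball x₀ (r / 2), isOpen_univ.prod isOpen_ball,
      ⟨mem_univ _, mem_ball_self (by linarith)⟩, ?_⟩
    rintro ⟨t, x⟩ ⟨⟨-, hx⟩, ⟨ht, -⟩⟩
    exact ⟨ht, ball_subset_closedBall hx⟩
  exact (hcont (t₀, x₀) ⟨ht₀, mem_closedBall_self (by linarith)⟩).mono_of_mem_nhdsWithin hmem

end IsDriftHeatSolutionOn

end Literature.Analysis.FluidPDE

end
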